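import Literature.NumberTheory.Transcendental.LWMeasureAnalytic
import Literature.NumberTheory.Transcendental.LindemannWeierstrassMeasureProofs
import Literature.NumberTheory.Transcendental.LindemannWeierstrassMeasure
import Literature.NumberTheory.Transcendental.QuantitativeCIAPolynomial
import Literature.NumberTheory.Transcendental.LWMeasureTheoremArith
import HarnessLib

/-!
# Ably's measure of algebraic independence for `e^{y₁}, …, e^{yₙ}` — §III: the theorem from the criterion and the main proposition

`Literature/NumberTheory/Transcendental/LWMeasureTheorem.lean` — proofs only (no definitions,
no named facts, nothing asserted). The last step ("§III. Preuve du théorème", pp. 42–44) of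
M. Ably, *Une version quantitative du théorème de Lindemann–Weierstrass*, Acta Arith. 67 (1994)
29–45, behind the named fact `Ably1994_lindemannWeierstrass_measure`
(`LindemannWeierstrassMeasure.lean`), in the tree's `ℚ`-setting: the measure
`log |P(e^{y₁}, …, e^{yₙ})| ≥ −c₂ Dⁿ (log H + exp(C Dⁿ log(D+1)))` is DEDUCED from

* the affine quantitative criterion for algebraic independence (Ably's "Critère", §I p. 31, over
  `ℚ`, for the point `(α, e^{y₁}, …, e^{yₙ}) ∈ ℂ^{n+1}` of transcendence degree `≤ n`, `α` an
  integral generator of `ℚ(y)`) — hypothesis `hcrit`, the statement of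
  `QuantCIA.exists_const_affine_measure`;
* the "Proposition principale" (§II p. 33) in the tree's parametrisation — hypothesis `hMP`: for
  `M ≥ M₀` and `R ≥ exp(c_E Mⁿ log M)` a finite family `Q_i ∈ ℤ[w, X₁, …, Xₙ]` of degrees
  `≤ c_δ M`, sizes `log ‖Q_i‖₁ ≤ c_τ R / Mⁿ`, values `|Q_i(α, e^y)| ≤ e^{−R}` and without common
  zero within `e^{−2R}` of `(α, e^y)`;

by the choice of parameters of §III (simplified: `σ = 2`, `M ≍ D`, `δ = (c_δ+1)M`,
`U = A Mⁿ(D + log H) + Mⁿ exp(c_E Mⁿ log M)/c_τ + 2(n+1)(c_δ+1)M^{n+1}/c_τ + 1`,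
`τ = c_τ U / Mⁿ`; at the scale `S` the proposition is applied with `R = S σⁿ ∈ (τ, U]`), the
sign `P(e^y) ≠ 0` being the Lindemann–Weierstrass theorem (`Ably1994.aeval_cexp_ne_zero`) and
the degenerate ranges (`n = 0`, constant `P`) being `LindemannWeierstrassMeasureProofs.lean`.
Both inputs are HYPOTHESES here (`ably1994_of_criterion_of_mainProp`); the real-arithmetic
bookkeeping is `LWMeasureTheoremArith.lean` (`thmIII_arith_*`).

## References

* [Ably1994] M. Ably, *Une version quantitative du théorème de Lindemann–Weierstrass*, Acta Arith.
  67 (1994) 29–45: Théorème (p. 30), §I Critère (p. 31), §II Proposition principale (p. 33),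
  §III Preuve du théorème (pp. 42–44).
-/

noncomputable section

open MvPolynomial

namespace Literature.NumberTheory.Transcendental

namespace LWMeasure

/-! ### §III for `n = k + 1 ≥ 1`: the parameters -/

/-- **Ably 1994, §III (pp. 42–44), the choice of parameters**, for the point
`θ' = (α, e^{y₁}, …, e^{y_{k+1}}) ∈ ℂ^{k+2}`: from the criterion at `θ'` (constant `C`, `σ = 2`,
hypothesis `hcrit`) and the main proposition at `θ'` (hypothesis `hmain`) one gets `C₀, c₂ > 0`
with `|P(θ')| > exp(−c₂ D^{k+1} (log H + exp(C₀ D^{k+1} log(D+1))))` for every `P ∈ ℤ[w, X]`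
with `P(θ') ≠ 0`, `1 ≤ deg P ≤ D`, naive height `≤ H` (`H ≥ 1`). Parameters: `M = M₀ + ⌈A c_τ D⌉
+ ⌈c_τ⌉ + 4`, `δ = (c_δ+1)M`, `U = A M^{k+1}(D + log H) + M^{k+1} e^{c_E M^{k+1} log M}/c_τ +
2(k+2)(c_δ+1)M^{k+2}/c_τ + 1`, `τ = c_τ U/M^{k+1}`, `A = 2 C K q^k (c_δ+1)^{k+1}`; at the scale
`S` the proposition is used with `R = S·2^{k+1}`. [cite: Ably1994, §III pp. 42–44] -/
private theorem core {k : ℕ} (θ' : Fin (k + 1 + 1) → ℂ) {C K q cE cδ cτ : ℝ} {M₀ : ℕ}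
    (hC : 1 ≤ C) (hK : 2 ≤ K) (hq : 0 ≤ q) (hcE : 0 < cE) (hcδ : 0 < cδ) (hcτ : 0 < cτ)
    (hcrit : ∀ (δ τ U : ℝ), 1 ≤ δ → 2 * ((k + 1 + 1 : ℕ) : ℝ) * δ ≤ τ → τ < U →
      (∀ S : ℝ, τ < S * 2 ^ (k + 1) → S * 2 ^ (k + 1) ≤ U →
        ∃ (ι : Type) (_ : Fintype ι) (Q : ι → MvPolynomial (Fin (k + 1 + 1)) ℤ),
          (∀ i, ((Q i).totalDegree : ℝ) ≤ δ) ∧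
          (∀ i, Real.log (Chudnovsky.l1 (Q i)) ≤ τ) ∧
          (∀ i, ‖MvPolynomial.aeval θ' (Q i)‖ ≤ Real.exp (-(S * 2 ^ (k + 1)))) ∧
          ∀ z : Fin (k + 1 + 1) → ℂ, (∀ i, ‖z i - θ' i‖ < Real.exp (-(S * 2 ^ (k + 2)))) →
            ∃ i, MvPolynomial.aeval z (Q i) ≠ 0) →
      ∀ P : MvPolynomial (Fin (k + 1 + 1)) ℤ, MvPolynomial.aeval θ' P ≠ 0 → 1 ≤ P.totalDegree →
        C * K * (q * δ) ^ k *
            (δ * (P.totalDegree + Real.log (mvPolyHeight P)) + τ * P.totalDegree) ≤ U →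
        Real.exp (-U) < ‖MvPolynomial.aeval θ' P‖)
    (hmain : ∀ M : ℕ, M₀ ≤ M → ∀ R : ℝ,
      Real.exp (cE * (M : ℝ) ^ (k + 1) * Real.log (M : ℝ)) ≤ R →
        ∃ (ι : Type) (_ : Fintype ι) (Q : ι → MvPolynomial (Fin (k + 1 + 1)) ℤ),
          (∀ i, ((Q i).totalDegree : ℝ) ≤ cδ * M) ∧
          (∀ i, Real.log (Chudnovsky.l1 (Q i)) ≤ cτ * R / (M : ℝ) ^ (k + 1)) ∧
          (∀ i, ‖MvPolynomial.aeval θ' (Q i)‖ ≤ Real.exp (-R)) ∧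
          ∀ x : Fin (k + 1 + 1) → ℂ, (∀ j, ‖x j - θ' j‖ < Real.exp (-(2 * R))) →
            ∃ i, MvPolynomial.aeval x (Q i) ≠ 0) :
    ∃ C₀ c₂ : ℝ, 0 < C₀ ∧ 0 < c₂ ∧ ∀ (P : MvPolynomial (Fin (k + 1 + 1)) ℤ) (D H : ℕ),
      MvPolynomial.aeval θ' P ≠ 0 → 1 ≤ P.totalDegree → P.totalDegree ≤ D → 1 ≤ H →
      (mvPolyHeight P : ℝ) ≤ H →
        Real.exp (-(c₂ * (D : ℝ) ^ (k + 1) *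
            (Real.log H + Real.exp (C₀ * (D : ℝ) ^ (k + 1) * Real.log ((D : ℝ) + 1))))) <
          ‖MvPolynomial.aeval θ' P‖ := by
  -- the constants depending on `y` alone
  have hC0 : 0 ≤ C := by linarith
  have hK0 : 0 ≤ K := by linarith
  set A : ℝ := 2 * C * K * q ^ k * (cδ + 1) ^ (k + 1) with hA
  have hA0 : 0 ≤ A := by positivity
  set B : ℝ := (M₀ : ℝ) + A * cτ + cτ + 6 with hB
  have hB6 : 6 ≤ B := by
    have : (0 : ℝ) ≤ M₀ := Nat.cast_nonneg _
    have := mul_nonneg hA0 hcτ.le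
    linarith
  have hlogB : 0 ≤ Real.log B := Real.log_nonneg (by linarith)
  have hC₀ : 0 < cE * B ^ (k + 1) * (2 * Real.log B + 1) + 1 := by
    have : 0 ≤ cE * B ^ (k + 1) * (2 * Real.log B + 1) := by positivity
    linarith
  refine ⟨cE * B ^ (k + 1) * (2 * Real.log B + 1) + 1,
    A * B ^ (k + 1) + B ^ (k + 1) / cτ +
      2 * ((k + 1 + 1 : ℕ) : ℝ) * (cδ + 1) * B ^ (k + 1 + 1) / cτ + 1,
    hC₀, by positivity, fun P D H hP0 hdeg1 hdegD hH1 hHP => ?_⟩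
  -- the parameters depending on `D`, `H`
  have hD1 : (1 : ℝ) ≤ D := by exact_mod_cast hdeg1.trans hdegD
  set M : ℕ := M₀ + ⌈A * cτ * D⌉₊ + ⌈cτ⌉₊ + 4 with hM
  obtain ⟨hM₀M, hcM, hAM, hMB⟩ := thmIII_arith_M hA0 hcτ hD1 hM
  have hMpos : (0 : ℝ) < M := by linarith
  have hM1 : (1 : ℝ) ≤ M := by linarith
  set Rm : ℝ := Real.exp (cE * (M : ℝ) ^ (k + 1) * Real.log (M : ℝ)) with hRm
  set LH : ℝ := Real.log H with hLH
  have hLH0 : 0 ≤ LH := Real.log_nonneg (by exact_mod_cast hH1)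
  set U : ℝ := A * (M : ℝ) ^ (k + 1) * ((D : ℝ) + LH) + (M : ℝ) ^ (k + 1) * Rm / cτ +
      2 * ((k + 1 + 1 : ℕ) : ℝ) * (cδ + 1) * (M : ℝ) ^ (k + 1 + 1) / cτ + 1 with hU
  set δ : ℝ := (cδ + 1) * M with hδ
  set τ : ℝ := cτ * U / (M : ℝ) ^ (k + 1) with hτ
  have hT0 : 0 ≤ A * (M : ℝ) ^ (k + 1) * ((D : ℝ) + LH) := by positivity
  obtain ⟨hδ1, h2mδ, hτU, hRmτ, hU0⟩ :=
    thmIII_arith_params (k := k) hcδ.le hcτ hcM (Real.exp_pos _).le hT0 hU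
  -- the families of the main proposition at the scales of the criterion
  have hfam : ∀ S : ℝ, τ < S * 2 ^ (k + 1) → S * 2 ^ (k + 1) ≤ U →
      ∃ (ι : Type) (_ : Fintype ι) (Q : ι → MvPolynomial (Fin (k + 1 + 1)) ℤ),
        (∀ i, ((Q i).totalDegree : ℝ) ≤ δ) ∧
        (∀ i, Real.log (Chudnovsky.l1 (Q i)) ≤ τ) ∧
        (∀ i, ‖MvPolynomial.aeval θ' (Q i)‖ ≤ Real.exp (-(S * 2 ^ (k + 1)))) ∧
        ∀ z : Fin (k + 1 + 1) → ℂ, (∀ i, ‖z i - θ' i‖ < Real.exp (-(S * 2 ^ (k + 2)))) →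
          ∃ i, MvPolynomial.aeval z (Q i) ≠ 0 := by
    intro S hS hSU
    obtain ⟨ι, hι, Q, hQdeg, hQh, hQval, hQzero⟩ :=
      hmain M hM₀M (S * 2 ^ (k + 1)) (hRmτ.trans hS.le)
    refine ⟨ι, hι, Q, fun i => (hQdeg i).trans ?_, fun i => (hQh i).trans ?_, hQval,
      fun z hz => hQzero z fun j => ?_⟩
    · rw [hδ]; nlinarith
    · exact div_le_div_of_nonneg_right (mul_le_mul_of_nonneg_left hSU hcτ.le) (by positivity)
    · have h := hz j
      rwa [show S * 2 ^ (k + 2) = 2 * (S * 2 ^ (k + 1)) by ring] at h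
  -- the budget of the criterion
  have hlogHP : Real.log (mvPolyHeight P) ≤ LH := by
    rcases (Nat.cast_nonneg (mvPolyHeight P) : (0 : ℝ) ≤ _).eq_or_lt with h0 | hpos
    · rw [← h0, Real.log_zero]; exact hLH0
    · exact Real.log_le_log hpos hHP
  have hUT : A * (M : ℝ) ^ (k + 1) * ((D : ℝ) + LH) ≤ U := by
    have : 0 ≤ (M : ℝ) ^ (k + 1) * Rm / cτ := by positivity
    have : 0 ≤ 2 * ((k + 1 + 1 : ℕ) : ℝ) * (cδ + 1) * (M : ℝ) ^ (k + 1 + 1) / cτ := by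
      positivity
    rw [hU]; linarith
  have hcond : C * K * (q * δ) ^ k *
      (δ * (P.totalDegree + Real.log (mvPolyHeight P)) + τ * P.totalDegree) ≤ U :=
    thmIII_arith_cond hA hC0 hK0 hq hcδ.le hcτ.le hMpos hAM (Nat.cast_nonneg _)
      (by exact_mod_cast hdegD) hlogHP hU0.le hUT
  have key := hcrit δ τ U hδ1 h2mδ hτU hfam P hP0 hdeg1 hcond
  -- the size of `U`
  refine lt_of_le_of_lt (Real.exp_le_exp.mpr (neg_le_neg ?_)) key
  rw [hU]
  exact thmIII_arith_final hA0 hB6 hcE.le hcδ.le hcτ hD1 hLH0 hM1 hMB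

/-! ### The theorem -/

/-- **Ably 1994, Théorème (p. 30) from the Critère (§I) and the Proposition principale (§II),
by the choice of parameters of §III (pp. 42–44).** Given the affine quantitative criterion for
algebraic independence over `ℚ` (hypothesis `hcrit`, the statement of
`QuantCIA.exists_const_affine_measure`) and the main proposition for every datum `S : Setup`
(hypothesis `hMP`), the measure `Ably1994_lindemannWeierstrass_measure` holds: for
`ℚ`-linearly independent algebraic `y₁, …, yₙ` there are `C, c₂ > 0` with
`|P(e^{y₁}, …, e^{yₙ})| ≥ exp(−c₂ Dⁿ (log H + exp(C Dⁿ log(D+1))))` for every non-zero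
`P ∈ ℤ[X₁, …, Xₙ]` of degree `≤ D` and naive height `≤ H`. The case `n = 0` and constant `P`
are the degenerate ranges (`LindemannWeierstrassMeasureProofs.lean`); for `n ≥ 1` the criterion
is applied at `(α, e^{y₁}, …, e^{yₙ}) ∈ ℂ^{n+1}` (`α` an integral generator of `ℚ(y)`,
transcendence degree `≤ n`) to `P` read in `ℤ[w, X₁, …, Xₙ]`, whose value is non-zero by the
Lindemann–Weierstrass theorem. [cite: Ably1994, §III pp. 42–44 (Preuve du théorème)] -/
theorem ably1994_of_criterion_of_mainProp
    (hcrit : ∀ (m k : ℕ), k + 1 < m → ∀ (θ : Fin m → ℂ),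
      Algebra.trdeg ℚ ↥(IntermediateField.adjoin ℚ (Set.range θ)) ≤ ((k + 1 : ℕ) : Cardinal) →
      ∃ C : ℝ, 1 ≤ C ∧ ∀ (δ τ σ U : ℝ), 1 ≤ δ → 2 * m * δ ≤ τ → 1 ≤ σ → τ < U →
        (∀ S : ℝ, τ < S * σ ^ (k + 1) → S * σ ^ (k + 1) ≤ U →
          ∃ (ι : Type) (_ : Fintype ι) (Q : ι → MvPolynomial (Fin m) ℤ),
            (∀ i, ((Q i).totalDegree : ℝ) ≤ δ) ∧
            (∀ i, Real.log (Chudnovsky.l1 (Q i)) ≤ τ) ∧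
            (∀ i, ‖MvPolynomial.aeval θ (Q i)‖ ≤ Real.exp (-(S * σ ^ (k + 1)))) ∧
            ∀ z : Fin m → ℂ, (∀ i, ‖z i - θ i‖ < Real.exp (-(S * σ ^ (k + 2)))) →
              ∃ i, MvPolynomial.aeval z (Q i) ≠ 0) →
        ∀ P : MvPolynomial (Fin m) ℤ, MvPolynomial.aeval θ P ≠ 0 → 1 ≤ P.totalDegree →
          C * QuantCIA.KConst m k σ θ * (QuantCIA.qConst m k σ * δ) ^ k *
              (δ * (P.totalDegree + Real.log (mvPolyHeight P)) + τ * P.totalDegree) ≤ U →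
          Real.exp (-U) < ‖MvPolynomial.aeval θ P‖)
    (hMP : ∀ S : Setup, ∃ (M₀ : ℕ) (cE cδ cτ : ℝ), 0 < cE ∧ 0 < cδ ∧ 0 < cτ ∧
      ∀ (M : ℕ), M₀ ≤ M → ∀ (R : ℝ), Real.exp (cE * (M : ℝ) ^ S.n * Real.log (M : ℝ)) ≤ R →
        ∃ (ι : Type) (_ : Fintype ι) (Q : ι → MvPolynomial (Fin (S.n + 1)) ℤ),
          (∀ i, ((Q i).totalDegree : ℝ) ≤ cδ * M) ∧
          (∀ i, Real.log (Chudnovsky.l1 (Q i)) ≤ cτ * R / (M : ℝ) ^ S.n) ∧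
          (∀ i, ‖MvPolynomial.aeval (Fin.cons S.α S.θ : Fin (S.n + 1) → ℂ) (Q i)‖ ≤ Real.exp (-R)) ∧
          ∀ x : Fin (S.n + 1) → ℂ,
            (∀ k, ‖x k - (Fin.cons S.α S.θ : Fin (S.n + 1) → ℂ) k‖ < Real.exp (-(2 * R))) →
            ∃ i, MvPolynomial.aeval x (Q i) ≠ 0) :
    Ably1994_lindemannWeierstrass_measure := by
  intro n y halg hli
  cases n with
  | zero => exact Ably1994.ably1994_measure_fin_zero y
  | succ k =>
  classical
  -- the data: an integral generator `α` of `ℚ(y)` and its minimal polynomial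
  obtain ⟨α, R, c, hαint, hc, hcy⟩ := exists_generator y halg
  obtain ⟨M₀, cE, cδ, cτ, hcE, hcδ, hcτ, hmain⟩ :=
    hMP ⟨k + 1, Nat.succ_pos k, y, halg, hli, α, R, c, minpoly ℤ α, hc, minpoly.monic hαint,
      minpoly.natDegree_pos hαint, minpoly.aeval ℤ α, hcy⟩
  set θ' : Fin (k + 1 + 1) → ℂ := Fin.cons α (fun i => Complex.exp (y i)) with hθ'
  -- `trdeg_ℚ ℚ(α, e^y) ≤ k + 1`
  have hαalg : IsAlgebraic ℚ α := (IsFractionRing.isAlgebraic_iff ℤ ℚ ℂ).mp hαint.isAlgebraic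
  have htr : Algebra.trdeg ℚ ↥(IntermediateField.adjoin ℚ (Set.range θ')) ≤
      ((k + 1 : ℕ) : Cardinal) := by
    refine (QuantCIA.trdeg_adjoin_range_le_card (F := ℚ) θ'
      (Finset.univ.image fun i => Complex.exp (y i)) fun i hi => ?_).trans ?_
    · revert hi
      refine Fin.cases (fun _ => ?_) (fun j hj => ?_) i
      · simpa [hθ'] using hαalg
      · exfalso; apply hj
        rw [hθ', Fin.cons_succ]
        exact Finset.mem_image_of_mem (fun i => Complex.exp (y i)) (Finset.mem_univ j)
    · have : (Finset.univ.image fun i => Complex.exp (y i)).card ≤ k + 1 :=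
        Finset.card_image_le.trans (by simp)
      exact_mod_cast this
  -- the criterion at `θ'` with `σ = 2`, and §III
  obtain ⟨C, hC1, hC⟩ := hcrit (k + 1 + 1) k (by omega) θ' htr
  have hq : 0 ≤ QuantCIA.qConst (k + 1 + 1) k 2 := by unfold QuantCIA.qConst; positivity
  obtain ⟨C₀, c₂, hC₀, hc₂, hmeas⟩ := core θ' hC1
    (QuantCIA.two_le_KConst (k + 1 + 1) k (by norm_num : (1 : ℝ) ≤ 2) θ') hq hcE hcδ hcτ
    (fun δ τ U h1 h2 h3 => hC δ τ 2 U h1 h2 (by norm_num) h3) hmain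
  refine ⟨C₀, c₂, hC₀, hc₂, fun P D H hP hdeg hH => ?_⟩
  rcases Nat.eq_zero_or_pos P.totalDegree with h0 | hpos
  · exact Ably1994.ablyBound_le_norm_aeval_of_totalDegree_eq_zero hc₂.le _ hP h0 D hH
  -- `P` read in `ℤ[w, X₁, …, Xₙ]`
  have hH1 : 1 ≤ H := Ably1994.one_le_of_coeff_abs_le hP hH
  have heval : MvPolynomial.aeval θ' (rename Fin.succ P) =
      MvPolynomial.aeval (fun i => Complex.exp (y i)) P := by
    rw [MvPolynomial.aeval_rename]; rfl
  have hP'0 : MvPolynomial.aeval θ' (rename Fin.succ P) ≠ 0 := by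
    rw [heval]; exact Ably1994.aeval_cexp_ne_zero y halg hli hP
  have hdeg' : (rename Fin.succ P).totalDegree = P.totalDegree :=
    totalDegree_rename_of_injective (Fin.succ_injective _) P
  have hHP' : (mvPolyHeight (rename Fin.succ P) : ℝ) ≤ H := by
    exact_mod_cast mvPolyHeight_rename_le_of_injective (Fin.succ_injective _) hH
  have key := hmeas (rename Fin.succ P) D H hP'0 (by rw [hdeg']; exact hpos)
    (by rw [hdeg']; exact hdeg) hH1 hHP'
  rw [heval] at key
  exact key.le

end LWMeasure

end Literature.NumberTheory.Transcendental

end
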